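import Summits.HodgeConjecture.HodgeConjecture.Theorems.HCCMUnconditionalHDelOfRelDimF
import Summits.HodgeConjecture.HodgeConjecture.Theorems.HCCMUnconditionalHLiu418OfH415
import HarnessLib

/-!
# GENERIC FLOOR EDITION v6 «Fal OUT» — HC_CM from FIVE generic inputs {(F′), dictE, J3a, occ, 415}: the [Fal83] binder DELETED

Topic: summit `HodgeConjecture`, sub-problem `HodgeConjecture`, route `HCCMUnconditional`.  A STATUS theorem (cell hodgecm-mathlib, D-0175 plan
(A2) «FLOOR v6 — Fal OUT»; pen A-plan2 (g11) `A-plan/floor-v6/FLOOR-V6-SPEC.md`, WORD 18:15:14Z (3); author A-p01 (g8), prover 2 «direct glue»;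
twin of record A-p09 (g12); order of record director g9 18:22:29Z: floor v5 FIRST, v6/v11 ON TOP).  THEOREMS ONLY, namespace
`Summit.HodgeConjecture.HodgeConjecture.Theorems`, DEFAULT heartbeats.

★ `hc_cm_of_generic_floor_v5` (B-p18 (g16), `HCCMUnconditionalHDelOfRelDimF.lean`) concludes `RankFourFaces.CMAbelianHodge` (= `HC_CM`) from SIX
generic inputs: (F′) `hF′ : lan2013_siegelFineModuliScheme_relDim` ([Lan13] Thm. 1.4.1.11 + [GW II] Thm. 27.301), III-2 (a)′ `hdictE`, III-J3a `hJ3a`,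
III-2 (c)′ `hocc` (the Rogawski trio), VI-1 `hFal : ∀ K A B ℓ, faltings_tate_bijective A B ℓ` ([Faltings1983] Satz 4) and III-9′ `h415 : Thm415AtFace`
([Liu2021] Thm. 4.15 at the face = [MR92] Prop. 6).  THIS EDITION deletes `hFal`: the Faltings–isotypic slot of hLiu418 is DERIVED from the item `H413`
(itself ⇐ the trio) by LINE T5′ — ★ `HypLiu418.HLiu418_of_h415` (`HCCMUnconditionalHLiu418OfH415.lean`, over ★ F3b `hF_of_h413` and ★ (J2)
`stubFaltingsIsotypic_of_hF`: the Albanese of the GS curve is of CM type, and CM abelian varieties satisfy Tate's isogeny statement without Faltings).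
Body = the floor's `closes` call with `hDel := HDel_of_relDim_F hF′` (★, (F′) ⇒ (F)+(U) ⇒ M1′ ⇒ hDel), `h21 := H21_proof`, `h413 := H413_of_three_facts_flat
hdictE hJ3a hocc`, `hLiu418 := HLiu418_of_h415 h415 h21 h413`, and H411/HD3/HD1″ closed — i.e. `hc_cm_of_generic_floor_v5` with ONE binder deleted and ONE
slot token swapped (decl-compare: A-p09 (g12) 18:14:10Z / A-plan2 (g11) 18:15:14Z on the sibling editions).  Hypotheses = EXACTLY FIVE:
(F′) `hF'`, III-2 (a)′ `hdictE`, III-J3a `hJ3a`, III-2 (c)′ `hocc`, III-9′ `h415` (generic kind; v5 had 6, v4 had 7).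

HC_CM is proved only modulo the 7 printed citations until rung 0 closes; this STATUS theorem says: modulo the FIVE printed statements above (generic floor).
-/

set_option autoImplicit false

-- mandated namespace `Summit.HodgeConjecture.HodgeConjecture.Theorems` trips `linter.dupNamespace` (single-problem summit); off as in
-- `HCCMUnconditionalOfFloor.lean` / `HCCMUnconditionalOfGenericFloorV2.lean` / `…V3.lean` / `HCCMUnconditionalHDelOfFU.lean`.
set_option linter.dupNamespace false

noncomputable section

namespace Summit.HodgeConjecture.HodgeConjecture.Theorems

open scoped TensorProduct Matrix
open NumberField NumberField.InfinitePlace IsDedekindDomain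
open HodgeCM.Model HodgeCM.Model.LiuIndex HodgeCM.Model.TowerCarrier
open Summit.HodgeConjecture.CorCM.Model
open Literature.AlgebraicGeometry.Motives (CMType AbelianVariety)
open Literature.AlgebraicGeometry.HodgeTheory Literature.NumberTheory.Automorphic.PicardCM
open Literature.AlgebraicGeometry.ShimuraVarieties Literature.AlgebraicGeometry.ShimuraVarieties.UnitaryCanonicalModel
open Literature.NumberTheory.ComplexMultiplication
open Literature.NumberTheory.Automorphic
open Literature.NumberTheory.Automorphic.Liu2021 Literature.NumberTheory.Automorphic.Liu2021.AppendixC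
open Literature.NumberTheory.Automorphic.Liu2021.Def411WeilCarriers (lineOf locF Rep)
open Summit.HodgeConjecture.CorCM.Transposition.OmegaTransport (realUnit)
open HodgeCM.Model.ArchSideTerm (e₁)
open Literature.NumberTheory.GelbartRogawski1991 Literature.NumberTheory.GelbartRogawski1991.UnitaryDualPair
open Literature.RepresentationTheory Literature.RepresentationTheory.Liu2021
open Summit.HodgeConjecture.CorCM
open Summit.HodgeConjecture.CorCM.Transposition
open Literature.NumberTheory.GelbartRogawski1991.OscillatorTripleDictionary (OccursInH1 IsIsoToOmega)
open Summit.HodgeConjecture.CorCM.Lines.A3Liu418 (Thm415AtFace EpsRigidAtFace)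
open Summit.HodgeConjecture.HodgeConjecture.Theses (HCCMUnconditional.HDel)

/-- **GENERIC FLOOR EDITION v6 «Fal OUT» ((F′) currency)**: `hc_cm_of_generic_floor_v5` (inputs (F′), dictE, J3a, occ, Fal, 415) with its row VI-1 binder `hFal`
([Faltings1983] Satz 4) DELETED — the Faltings–isotypic slot of hLiu418 is derived from the item `H413` by LINE T5′ (★ `HypLiu418.HLiu418_of_h415`).
`hDel := HDel_of_relDim_F hF′` ((F′) ⇒ (F) + (U): ★ `lan2013_of_relDim`, ★ `UOfF.U_of_relDim_F`, ★ E-FU), `h21 := H21_proof`, `h413 := H413_of_three_facts_flat hdictE hJ3a hocc`,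
H411/HD3/HD1″ closed.  Hypotheses = EXACTLY: (F′) `hF'`, III-2 (a)′ `hdictE`, III-J3a `hJ3a`, III-2 (c)′ `hocc`, III-9′ `h415` (**5**, generic kind; v5 had 6).
A STATUS theorem: HC_CM is proved only modulo the 7 printed citations until rung 0 closes.
[cite: Lan2013PELCompactifications, Thm. 1.4.1.11 and Cor. 7.2.3.10] [cite: GortzWedhorn2023, Thm. 27.301 (p. 733)] [cite: MumfordFogartyKirwan1994, Thm. 7.9 and App. 7A]
[cite: Liu2021, Thm. 4.18; Prop. 4.13 and its proof l. 2145; Rem. 4.14; Thm. 4.15; App. D Lem. D.1] [cite: GelbartRogawski1991, Thm. 5.1.1 (p. 448); p. 446]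
[cite: Li1992, Thm. 2.1] [cite: Rogawski1990, Thm. 13.3.1] [cite: Shimura1998, Thm. 21.4; Thm. 18.6] -/
theorem hc_cm_of_generic_floor_v6
    -- `hDel` ⇐ (F′) via ★ `HDel_of_relDim_F`
    (hF' : Literature.AlgebraicGeometry.ModuliOfAbelianVarieties.lan2013_siegelFineModuliScheme_relDim)
    -- `h21` := the closed constant `Theorems.H21_proof`; `h413` ⇐ rows III-2 (a)′, III-J3a, III-2 (c)′; `hLiu418` ⇐ III-9′ + T5′ (NO [Fal83])
    (hdictE :
      ∀ (hDel : Literature.AlgebraicGeometry.ShimuraVarieties.UnitaryCanonicalModel.canonicalModel_exists_printed)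
        (F : HodgeCM.CMField) [IsGalois ℚ F] (h6 : 6 ≤ Module.finrank ℚ F) {ι₁ : F →+* ℂ} (V : HodgeCM.HermSpace3 F ι₁) (a₀ : RealScalar F)
        (Φ : CMType F) (hΦ : ι₁ ∈ Φ.1) (i : (I V (repAt a₀) (muLiu ι₁ GramClass.rep))),
        oscillatorTriple_dictionaryExistence (((uniformOmegaRep (Summit.HodgeConjecture.CorCM.DelRec.exists_recordSystem_of_printed hDel) ⟨HodgeCM.CMField.K F⟩ ι₁ ⟨HodgeCM.HermSpace3.Hm V, HodgeCM.HermSpace3.isHermitian V, HodgeCM.HermSpace3.signature_ι₁ V, HodgeCM.HermSpace3.posDef_of_ne V⟩ Φ e₁ (frameD V) (frameD_real V) (frameD_ne V) (ιVE V) (2 * imagUnit (HodgeCM.CMField.K F))⁻¹ (fun _ _ => (Rep.update ↥(maximalRealSubfield (HodgeCM.CMField.K F)) (imagUnitSq (HodgeCM.CMField.K F)) (Rep.ofLineOf ↥(maximalRealSubfield (HodgeCM.CMField.K F)) (imagUnitSq (HodgeCM.CMField.K F))) (locF ↥(maximalRealSubfield (HodgeCM.CMField.K F)) (imagUnitSq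 (HodgeCM.CMField.K F)) (realUnit ⟨HodgeCM.CMField.K F⟩ (repAt a₀ (Sigma.fst i)).1 (repAt a₀ (Sigma.fst i)).2.1 (repAt a₀ (Sigma.fst i)).2.2)) (realUnit ⟨HodgeCM.CMField.K F⟩ (repAt a₀ (Sigma.fst i)).1 (repAt a₀ (Sigma.fst i)).2.1 (repAt a₀ (Sigma.fst i)).2.2) rfl)))).prop413Data ((liuDictionaryPin exists_isReal_hodgeModel_holds hodgePQ_independent_of_hodgeModel_holds BallQuotient.ballQuotientUniformised_holds (cmAbelianVarietyRealised_of_eigenbasis exists_isReal_hodgeModel_holds hodgePQ_independent_of_hodgeModel_holds cmAbelianVarietyEigenbasisRealised_holds) Literature.NumberTheory.Transcendental.arapura2012_cor_15_4_6_holds V (I V (repAt a₀) (muLiu ι₁ GramClass.rep)) (line V (repAt a₀) (muLiu ι₁ GramClass.rep)))).H))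
    (hJ3a :
      ∀ (hDel : Literature.AlgebraicGeometry.ShimuraVarieties.UnitaryCanonicalModel.canonicalModel_exists_printed)
        (F : HodgeCM.CMField) [IsGalois ℚ F] (h6 : 6 ≤ Module.finrank ℚ F) {ι₁ : F →+* ℂ} (V : HodgeCM.HermSpace3 F ι₁) (a₀ : RealScalar F)
        (Φ : CMType F) (hΦ : ι₁ ∈ Φ.1) (i : (I V (repAt a₀) (muLiu ι₁ GramClass.rep))),
        (((uniformOmegaRep (Summit.HodgeConjecture.CorCM.DelRec.exists_recordSystem_of_printed hDel) ⟨HodgeCM.CMField.K F⟩ ι₁ ⟨HodgeCM.HermSpace3.Hm V, HodgeCM.HermSpace3.isHermitian V, HodgeCM.HermSpace3.signature_ι₁ V, HodgeCM.HermSpace3.posDef_of_ne V⟩ Φ e₁ (frameD V) (frameD_real V) (frameD_ne V) (ιVE V) (2 * imagUnit (HodgeCM.CMField.K F))⁻¹ (fun _ _ => (Rep.update ↥(maximalRealSubfield (HodgeCM.CMField.K F)) (imagUnitSq (HodgeCM.CMField.K F)) (Rep.ofLineOf ↥(maximalRealSubfield (HodgeCM.CMField.K F)) (imagUnitSq (HodgeCM.CMField.K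 F))) (locF ↥(maximalRealSubfield (HodgeCM.CMField.K F)) (imagUnitSq (HodgeCM.CMField.K F)) (realUnit ⟨HodgeCM.CMField.K F⟩ (repAt a₀ (Sigma.fst i)).1 (repAt a₀ (Sigma.fst i)).2.1 (repAt a₀ (Sigma.fst i)).2.2)) (realUnit ⟨HodgeCM.CMField.K F⟩ (repAt a₀ (Sigma.fst i)).1 (repAt a₀ (Sigma.fst i)).2.1 (repAt a₀ (Sigma.fst i)).2.2) rfl)))).prop413Data ((liuDictionaryPin exists_isReal_hodgeModel_holds hodgePQ_independent_of_hodgeModel_holds BallQuotient.ballQuotientUniformised_holds (cmAbelianVarietyRealised_of_eigenbasis exists_isReal_hodgeModel_holds hodgePQ_independent_of_hodgeModel_holds cmAbelianVarietyEigenbasisRealised_holds) Literature.NumberTheory.Transcendental.arapura2012_cor_15_4_6_holds V (I V (repAt a₀) (muLiu ι₁ GramClass.rep)) (line V (repAt a₀) (muLiu ι₁ GramClass.rep)))).H).multiplicity_le_one_printed)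
    (hocc :
      ∀ (hDel : Literature.AlgebraicGeometry.ShimuraVarieties.UnitaryCanonicalModel.canonicalModel_exists_printed)
        (F : HodgeCM.CMField) [IsGalois ℚ F] (h6 : 6 ≤ Module.finrank ℚ F) {ι₁ : F →+* ℂ} (V : HodgeCM.HermSpace3 F ι₁) (a₀ : RealScalar F)
        (Φ : CMType F) (hΦ : ι₁ ∈ Φ.1) (i : (I V (repAt a₀) (muLiu ι₁ GramClass.rep))),
        admissible_occursInH1 (((uniformOmegaRep (Summit.HodgeConjecture.CorCM.DelRec.exists_recordSystem_of_printed hDel) ⟨HodgeCM.CMField.K F⟩ ι₁ ⟨HodgeCM.HermSpace3.Hm V, HodgeCM.HermSpace3.isHermitian V, HodgeCM.HermSpace3.signature_ι₁ V, HodgeCM.HermSpace3.posDef_of_ne V⟩ Φ e₁ (frameD V) (frameD_real V) (frameD_ne V) (ιVE V) (2 * imagUnit (HodgeCM.CMField.K F))⁻¹ (fun _ _ => (Rep.update ↥(maximalRealSubfield (HodgeCM.CMField.K F)) (imagUnitSq (HodgeCM.CMField.K F)) (Rep.ofLineOf ↥(maximalRealSubfield (HodgeCM.CMField.K F)) (imagUnitSq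 (HodgeCM.CMField.K F))) (locF ↥(maximalRealSubfield (HodgeCM.CMField.K F)) (imagUnitSq (HodgeCM.CMField.K F)) (realUnit ⟨HodgeCM.CMField.K F⟩ (repAt a₀ (Sigma.fst i)).1 (repAt a₀ (Sigma.fst i)).2.1 (repAt a₀ (Sigma.fst i)).2.2)) (realUnit ⟨HodgeCM.CMField.K F⟩ (repAt a₀ (Sigma.fst i)).1 (repAt a₀ (Sigma.fst i)).2.1 (repAt a₀ (Sigma.fst i)).2.2) rfl)))).prop413Data ((liuDictionaryPin exists_isReal_hodgeModel_holds hodgePQ_independent_of_hodgeModel_holds BallQuotient.ballQuotientUniformised_holds (cmAbelianVarietyRealised_of_eigenbasis exists_isReal_hodgeModel_holds hodgePQ_independent_of_hodgeModel_holds cmAbelianVarietyEigenbasisRealised_holds) Literature.NumberTheory.Transcendental.arapura2012_cor_15_4_6_holds V (I V (repAt a₀) (muLiu ι₁ GramClass.rep)) (line V (repAt a₀) (muLiu ι₁ GramClass.rep)))).H))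
    (h415 : Thm415AtFace) :
    Summit.HodgeConjecture.HodgeConjecture.Theses.RankFourFaces.CMAbelianHodge :=
  have h21 : Summit.HodgeConjecture.HodgeConjecture.Theses.HCCMUnconditional.H21 := H21_proof
  have hD3 := Summit.HodgeConjecture.CorCM.HypD3.hD3_of_twistRigidity
    Literature.RepresentationTheory.MoeglinVignerasWaldspurger1987.rankOne_theta_twist_rigidity_holds
  have h413 := Summit.HodgeConjecture.CorCM.Hyp413Closing.H413_of_three_facts_flat hdictE hJ3a hocc
  Summit.HodgeConjecture.HodgeConjecture.Theses.HCCMUnconditional.closes (HDel_of_relDim_F hF') h21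
    (Summit.HodgeConjecture.CorCM.HypLiu418.HLiu418_of_h415 h415 h21 h413) h413 H411_proof hD3 HD1pp_proof

end Summit.HodgeConjecture.HodgeConjecture.Theorems

end
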